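import Summits.CriticalPhenomena.PercolationContinuityZ3.Theorems.PercNearOneGluingNoHeavyQuantAD3FourAtomFlows
import HarnessLib

/-!
# QUANT lane R8, T-DEC, ROUTE 2: the admissibility of a four-atom law with a zero atom — NECESSITY half
# (weak duality at ONE layer with ONE explicit price system)

builds on p205010 (kernel theorem, internal audit signed; external expert review pending)

Support file (`--supports stmt-CriticalPhenomena-4575`), QUANT lane, seat prim-quant-arm-2 (gen 37), rung R8 of
`run/shared/lean/prim/quant/LADDER.md`; companion of `…QuantAD3FourAtomFlows` (sufficiency).  Memo
`run/shared/lean/prim/quant/prim-quant-arm-2-g37/AD3-GATE4-G37.md` §1.  Theorems only, standard axioms, no sorries.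

THE SETTING (as in the companion).  `L = QD[a, b, c, Z, A, B, C]`, `0 < a < b < c ≤ M`, masses `≥ 0` summing to `1`, mean
`T = aA + bB + cC`, floor `0 < y < 1`, `2a < T` (the atom `a` is a genuine low).  If `L` is DEC at the layer `j′ = a`, the price
system `α ≡ y/(1−y)`, `β ≡ 1` (every absorber compatible with a low `≤ a` is a giant) gives H1: `y ≤ B + C`
(`fourAtom_H1_of_decAt`).  If `L` is DEC at the layer `j′ = b`, the price system `α = y/(1−y)` on `{0, a, b}`, `β = 1` on the
giants, `β_h = (y/(1−y))/usage(a,h)` on the mids compatible with `a` (dual-feasible because usage is antitone in the low,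
`usage_anti_low`) gives the MID INEQUALITY `(y/(1−y))·(Z + A + [2b<T]·B) ≤ [T ≤ 2b][T < a+b]·(y/(1−y))/usage(a,b)·B + C`
(`fourAtom_midDual_of_decAt`), i.e. H2 `y ≤ C` when `2b < T`, H3 `y(Z+A) ≤ (1−y)C` when `a + b ≤ T ≤ 2b`, and C1
`y(Z + A − B/usage(a,b)) ≤ (1−y)C` when `T < a + b`.  With the companion's sufficiency: **for a top-affordable four-atom law
with a zero atom, DEC at every layer is equivalent to ONE linear inequality in the masses** (`fourAtom_decAt_all_iff_*`).

* `LawDec.fourAtom_H1_of_decAt`, `LawDec.fourAtom_midDual_of_decAt`, `fourAtom_H2_of_decAt`, `fourAtom_H3_of_decAt`,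
  `fourAtom_C1_of_decAt`.
* **`LawDec.fourAtom_decAt_all_iff_threeLows`**, **`fourAtom_decAt_all_iff_incompatible`**, **`fourAtom_decAt_all_iff_corner`**.

[this work]; weak duality `dual_le_of_decAtT` (typer g22), `usage_anti_low` (lead g21) (this lane).  The gluing rows served
[cite: KozmaNitzan2024, Conjecture 3 (p. 15)]; product measure [cite: Grimmett1999, §1.3 p. 10].
-/

noncomputable section

namespace Summit.CriticalPhenomena.PercolationContinuityZ3.Theorems

namespace Quant

open Finset

/-- four-atom law notation `QD[a, b, c, Z, A, B, C, h] = Z·[h = 0] + A·[h = a] + B·[h = b] + C·[h = c]`. -/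
local notation3 "QD[" a ", " b ", " c ", " Z ", " A ", " B ", " C ", " h "]" =>
  (Z : ℝ) * (if (h : ℕ) = (0 : ℕ) then (1 : ℝ) else 0) + (A : ℝ) * (if (h : ℕ) = (a : ℕ) then (1 : ℝ) else 0)
    + (B : ℝ) * (if (h : ℕ) = (b : ℕ) then (1 : ℝ) else 0) + (C : ℝ) * (if (h : ℕ) = (c : ℕ) then (1 : ℝ) else 0)

namespace LawDec

/-! ### Layer `a`: H1 -/

/-- **H1 IS NECESSARY**: if `2a < T` and `L` is DEC at the layer `a` (`a < M`), then `y ≤ B + C`. [this work] -/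
theorem fourAtom_H1_of_decAt (y : ℝ) (M a b c : ℕ) (Z A B C : ℝ) (ha : 0 < a) (hab : a < b) (hbc : b < c)
    (hcM : c ≤ M) (hZ : 0 ≤ Z) (hA : 0 ≤ A) (hB : 0 ≤ B) (hC : 0 ≤ C) (hsum : Z + A + B + C = 1) (hy0 : 0 < y) (hy1 : y < 1)
    (h2a : 2 * (a : ℝ) < (a : ℝ) * A + (b : ℝ) * B + (c : ℝ) * C)
    (hD : DECAt y a M (fun h => QD[a, b, c, Z, A, B, C, h])) : y ≤ B + C := by
  obtain ⟨-, -, -, hmean⟩ := QD_laws M a b c Z A B C ha hab hbc hcM hZ hA hB hC hsum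
  set T : ℝ := (a : ℝ) * A + (b : ℝ) * B + (c : ℝ) * C with hT
  rw [decAt_iff_decAtT, hmean] at hD
  have h1y : 0 < 1 - y := by linarith
  have hT0 : 0 < T := lt_trans (by positivity) h2a
  have hdual := dual_le_of_decAtT y T a M _ hy0 hy1 hD (fun _ => y / (1 - y)) (fun _ => 1) (fun _ => zero_le_one)
    (fun l h hl hlow hhM hc => by
      rw [mul_one]
      by_cases hg : a + 1 ≤ h
      · rw [usage_giant_eq y T a l h hg]
      · exfalso
        rcases hc with hg' | hm
        · exact hg hg'
        · have h1 : (h : ℝ) ≤ a := by exact_mod_cast (show h ≤ a by omega)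
          have h2 : (l : ℝ) ≤ a := by exact_mod_cast hl
          linarith)
  -- evaluate both sides
  have eL : ∑ l ∈ Finset.range (a + 1), (if 2 * (l : ℝ) < T then y / (1 - y) * QD[a, b, c, Z, A, B, C, l] else 0)
      = y / (1 - y) * Z + y / (1 - y) * A := by
    have e : ∀ l : ℕ, (if 2 * (l : ℝ) < T then y / (1 - y) * QD[a, b, c, Z, A, B, C, l] else 0)
        = (if 2 * (l : ℝ) < T then y / (1 - y) else 0) * QD[a, b, c, Z, A, B, C, l] := by
      intro l; split_ifs <;> ring
    simp_rw [e]
    rw [sum_mul_QD _ _ a b c Z A B C, if_pos (show (0 : ℕ) ∈ Finset.range (a + 1) from Finset.mem_range.2 (Nat.succ_pos a)),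
      if_pos (show a ∈ Finset.range (a + 1) from Finset.mem_range.2 (Nat.lt_succ_self a)),
      if_neg (show b ∉ Finset.range (a + 1) by rw [Finset.mem_range]; omega),
      if_neg (show c ∉ Finset.range (a + 1) by rw [Finset.mem_range]; omega),
      if_pos (show 2 * ((0 : ℕ) : ℝ) < T by push_cast; linarith), if_pos h2a]
    ring
  have eR : ∑ h ∈ Finset.range (M + 1), (if h ≤ a ∧ 2 * (h : ℝ) < T then 0 else 1 * QD[a, b, c, Z, A, B, C, h]) = B + C := by
    have e : ∀ h : ℕ, (if h ≤ a ∧ 2 * (h : ℝ) < T then 0 else 1 * QD[a, b, c, Z, A, B, C, h])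
        = (if h ≤ a ∧ 2 * (h : ℝ) < T then 0 else (1 : ℝ)) * QD[a, b, c, Z, A, B, C, h] := by
      intro h; split_ifs <;> ring
    simp_rw [e]
    rw [sum_mul_QD _ _ a b c Z A B C, if_pos (show (0 : ℕ) ∈ Finset.range (M + 1) from Finset.mem_range.2 (by omega)),
      if_pos (show a ∈ Finset.range (M + 1) from Finset.mem_range.2 (by omega)),
      if_pos (show b ∈ Finset.range (M + 1) from Finset.mem_range.2 (by omega)),
      if_pos (show c ∈ Finset.range (M + 1) from Finset.mem_range.2 (by omega)),
      if_pos (show (0 : ℕ) ≤ a ∧ 2 * ((0 : ℕ) : ℝ) < T from ⟨Nat.zero_le a, by push_cast; linarith⟩),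
      if_pos (show a ≤ a ∧ 2 * (a : ℝ) < T from ⟨le_rfl, h2a⟩),
      if_neg (show ¬ (b ≤ a ∧ 2 * (b : ℝ) < T) from fun hc => absurd hc.1 (by omega)),
      if_neg (show ¬ (c ≤ a ∧ 2 * (c : ℝ) < T) from fun hc => absurd hc.1 (by omega))]
    ring
  rw [eL, eR] at hdual
  have : y / (1 - y) * (Z + A) ≤ B + C := by linarith
  rw [div_mul_eq_mul_div, div_le_iff₀ h1y] at this
  nlinarith

/-! ### Layer `b`: the mid inequality -/

/-- **THE MID INEQUALITY IS NECESSARY**: if `2a < T` and `L` is DEC at the layer `b` (`b < M`), then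
`(y/(1−y))·(Z + A + [2b<T]B) ≤ [¬ 2b<T][T<a+b]·(y/(1−y))/usage(a,b)·B + C`. [this work] -/
theorem fourAtom_midDual_of_decAt (y : ℝ) (M a b c : ℕ) (Z A B C : ℝ) (ha : 0 < a) (hab : a < b) (hbc : b < c)
    (hcM : c ≤ M) (hZ : 0 ≤ Z) (hA : 0 ≤ A) (hB : 0 ≤ B) (hC : 0 ≤ C) (hsum : Z + A + B + C = 1) (hy0 : 0 < y) (hy1 : y < 1)
    (h2a : 2 * (a : ℝ) < (a : ℝ) * A + (b : ℝ) * B + (c : ℝ) * C)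
    (hD : DECAt y b M (fun h => QD[a, b, c, Z, A, B, C, h])) :
    y / (1 - y) * (Z + A + (if 2 * (b : ℝ) < (a : ℝ) * A + (b : ℝ) * B + (c : ℝ) * C then B else 0))
      ≤ (if 2 * (b : ℝ) < (a : ℝ) * A + (b : ℝ) * B + (c : ℝ) * C then 0 else
          (if (a : ℝ) * A + (b : ℝ) * B + (c : ℝ) * C < (a : ℝ) + b then
            (y / (1 - y)) / usage y ((a : ℝ) * A + (b : ℝ) * B + (c : ℝ) * C) b a b * B else 0)) + C := by
  obtain ⟨-, -, -, hmean⟩ := QD_laws M a b c Z A B C ha hab hbc hcM hZ hA hB hC hsum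
  set T : ℝ := (a : ℝ) * A + (b : ℝ) * B + (c : ℝ) * C with hT
  rw [decAt_iff_decAtT, hmean] at hD
  have h1y : 0 < 1 - y := by linarith
  have hux : 0 < y / (1 - y) := div_pos hy0 h1y
  have hT0 : 0 < T := lt_trans (by positivity) h2a
  have ha' : (0 : ℝ) < a := by exact_mod_cast ha
  set u : ℝ := y / (1 - y) with hu
  -- the price system
  set α : ℕ → ℝ := fun l => if (l = 0 ∨ l = a ∨ l = b) then u else 0 with hα
  set β : ℕ → ℝ := fun h => if b + 1 ≤ h then (1 : ℝ) else (if T < (a : ℝ) + h then u / usage y T b a h else 0) with hβ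
  have hβ0 : ∀ h, 0 ≤ β h := by
    intro h
    simp only [hβ]
    split_ifs with hg hm
    · exact zero_le_one
    · have hah : a < h := by
        have : (a : ℝ) < h := by linarith
        exact_mod_cast this
      exact div_nonneg hux.le (usage_pos_of_compat y T b a h hy0 hy1 h2a hah (Or.inr hm)).le
    · exact le_rfl
  have hαβ : ∀ l h, l ≤ b → 2 * (l : ℝ) < T → h ≤ M → (b + 1 ≤ h ∨ T < (l : ℝ) + h) → α l ≤ usage y T b l h * β h := by
    intro l h hlb hlow hhM hc
    have hlh : l < h := by
      rcases hc with hg | hm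
      · omega
      · have : (l : ℝ) < h := by linarith
        exact_mod_cast this
    have hupos : 0 < usage y T b l h := usage_pos_of_compat y T b l h hy0 hy1 hlow hlh hc
    by_cases hl : l = 0 ∨ l = a ∨ l = b
    · have eα : α l = u := by simp only [hα, if_pos hl]
      rw [eα]
      by_cases hg : b + 1 ≤ h
      · have eβ : β h = 1 := by simp only [hβ, if_pos hg]
        rw [eβ, mul_one, usage_giant_eq y T b l h hg]
      · have hm : T < (l : ℝ) + h := hc.resolve_left hg
        rcases hl with hl0 | hla | hlb'
        · -- `l = 0`: `T < h`, so `h` is compatible with `a` as well, and usage is antitone in the low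
          rw [hl0] at hm
          have hm0 : T < (h : ℝ) := by simpa using hm
          have hm' : T < (a : ℝ) + h := by linarith [ha'.le]
          have eβ : β h = u / usage y T b a h := by simp only [hβ, if_neg hg, if_pos hm']
          have hah : a < h := by
            have : (a : ℝ) < h := by linarith
            exact_mod_cast this
          have hua := usage_pos_of_compat y T b a h hy0 hy1 h2a hah (Or.inr hm')
          have h0h : (0 : ℝ) ≤ h := Nat.cast_nonneg h
          have hanti := usage_anti_low y T b 0 a h hy0 hy1 ha h2a (by push_cast; linarith) (Or.inr (by linarith))
          rw [hl0, eβ, mul_div_assoc', le_div_iff₀ hua]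
          have := mul_le_mul_of_nonneg_left hanti hux.le
          linarith
        · -- `l = a`
          rw [hla] at hm ⊢
          have eβ : β h = u / usage y T b a h := by simp only [hβ, if_neg hg, if_pos hm]
          have hah : a < h := by
            have : (a : ℝ) < h := by linarith
            exact_mod_cast this
          have hua := usage_pos_of_compat y T b a h hy0 hy1 h2a hah (Or.inr hm)
          rw [eβ, mul_div_assoc', le_div_iff₀ hua]
          exact le_of_eq (mul_comm _ _)
        · -- `l = b`: `2b < T < b + h ≤ 2b`, impossible
          exfalso
          rw [hlb'] at hlow hm
          have : (h : ℝ) ≤ b := by exact_mod_cast (show h ≤ b by omega)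
          linarith
    · have eα : α l = 0 := by simp only [hα, if_neg hl]
      rw [eα]
      exact mul_nonneg hupos.le (hβ0 h)
  have hdual := dual_le_of_decAtT y T b M _ hy0 hy1 hD α β hβ0 hαβ
  -- evaluate both sides
  have e0 : α 0 = u := by simp only [hα, true_or, if_true]
  have ea : α a = u := by simp only [hα, true_or, or_true, if_true]
  have eb : α b = u := by simp only [hα, or_true, if_true]
  have ec : β c = 1 := by simp only [hβ, if_pos (show b + 1 ≤ c by omega)]
  have ebb : β b = (if T < (a : ℝ) + b then u / usage y T b a b else 0) := by
    simp only [hβ, if_neg (show ¬ (b + 1 ≤ b) by omega)]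
  have eL : ∑ l ∈ Finset.range (b + 1), (if 2 * (l : ℝ) < T then α l * QD[a, b, c, Z, A, B, C, l] else 0)
      = u * Z + u * A + (if 2 * (b : ℝ) < T then u * B else 0) := by
    have e : ∀ l : ℕ, (if 2 * (l : ℝ) < T then α l * QD[a, b, c, Z, A, B, C, l] else 0)
        = (if 2 * (l : ℝ) < T then α l else 0) * QD[a, b, c, Z, A, B, C, l] := by
      intro l; split_ifs <;> ring
    simp_rw [e]
    rw [sum_mul_QD _ _ a b c Z A B C, if_pos (show (0 : ℕ) ∈ Finset.range (b + 1) from Finset.mem_range.2 (Nat.succ_pos b)),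
      if_pos (show a ∈ Finset.range (b + 1) from Finset.mem_range.2 (by omega)),
      if_pos (show b ∈ Finset.range (b + 1) from Finset.mem_range.2 (Nat.lt_succ_self b)),
      if_neg (show c ∉ Finset.range (b + 1) by rw [Finset.mem_range]; omega),
      if_pos (show 2 * ((0 : ℕ) : ℝ) < T by push_cast; linarith), if_pos h2a, e0, ea, add_zero]
    by_cases h2b : 2 * (b : ℝ) < T
    · rw [if_pos h2b, if_pos h2b, eb]
    · rw [if_neg h2b, if_neg h2b]; ring
  have eR : ∑ h ∈ Finset.range (M + 1), (if h ≤ b ∧ 2 * (h : ℝ) < T then 0 else β h * QD[a, b, c, Z, A, B, C, h])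
      = (if 2 * (b : ℝ) < T then 0 else β b * B) + C := by
    have e : ∀ h : ℕ, (if h ≤ b ∧ 2 * (h : ℝ) < T then 0 else β h * QD[a, b, c, Z, A, B, C, h])
        = (if h ≤ b ∧ 2 * (h : ℝ) < T then 0 else β h) * QD[a, b, c, Z, A, B, C, h] := by
      intro h; split_ifs <;> ring
    simp_rw [e]
    rw [sum_mul_QD _ _ a b c Z A B C, if_pos (show (0 : ℕ) ∈ Finset.range (M + 1) from Finset.mem_range.2 (by omega)),
      if_pos (show a ∈ Finset.range (M + 1) from Finset.mem_range.2 (by omega)),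
      if_pos (show b ∈ Finset.range (M + 1) from Finset.mem_range.2 (by omega)),
      if_pos (show c ∈ Finset.range (M + 1) from Finset.mem_range.2 (by omega)),
      if_pos (show (0 : ℕ) ≤ b ∧ 2 * ((0 : ℕ) : ℝ) < T from ⟨Nat.zero_le b, by push_cast; linarith⟩),
      if_pos (show a ≤ b ∧ 2 * (a : ℝ) < T from ⟨hab.le, h2a⟩),
      if_neg (show ¬ (c ≤ b ∧ 2 * (c : ℝ) < T) from fun hc => absurd hc.1 (by omega)), ec]
    by_cases h2b : 2 * (b : ℝ) < T
    · rw [if_pos (show b ≤ b ∧ 2 * (b : ℝ) < T from ⟨le_rfl, h2b⟩), if_pos h2b]; ring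
    · rw [if_neg (show ¬ (b ≤ b ∧ 2 * (b : ℝ) < T) from fun hc => h2b hc.2), if_neg h2b]; ring
  rw [eL, eR, ebb] at hdual
  by_cases h2b : 2 * (b : ℝ) < T
  · rw [if_pos h2b, if_pos h2b]
    rw [if_pos h2b, if_pos h2b] at hdual
    linarith
  · rw [if_neg h2b, if_neg h2b]
    rw [if_neg h2b, if_neg h2b] at hdual
    by_cases hc : T < (a : ℝ) + b
    · rw [if_pos hc] at hdual ⊢; linarith
    · rw [if_neg hc] at hdual ⊢; linarith

/-- **H2 IS NECESSARY** (`2b < T`, DEC at layer `b`): `y ≤ C`. [this work] -/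
theorem fourAtom_H2_of_decAt (y : ℝ) (M a b c : ℕ) (Z A B C : ℝ) (ha : 0 < a) (hab : a < b) (hbc : b < c)
    (hcM : c ≤ M) (hZ : 0 ≤ Z) (hA : 0 ≤ A) (hB : 0 ≤ B) (hC : 0 ≤ C) (hsum : Z + A + B + C = 1) (hy0 : 0 < y) (hy1 : y < 1)
    (h2b : 2 * (b : ℝ) < (a : ℝ) * A + (b : ℝ) * B + (c : ℝ) * C)
    (hD : DECAt y b M (fun h => QD[a, b, c, Z, A, B, C, h])) : y ≤ C := by
  have hab' : (a : ℝ) < b := by exact_mod_cast hab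
  have h2a : 2 * (a : ℝ) < (a : ℝ) * A + (b : ℝ) * B + (c : ℝ) * C := by linarith
  have h := fourAtom_midDual_of_decAt y M a b c Z A B C ha hab hbc hcM hZ hA hB hC hsum hy0 hy1 h2a hD
  rw [if_pos h2b, if_pos h2b, zero_add] at h
  have h1y : 0 < 1 - y := by linarith
  rw [div_mul_eq_mul_div, div_le_iff₀ h1y] at h
  nlinarith

/-- **H3 IS NECESSARY** (`a + b ≤ T ≤ 2b`, `2a < T`, DEC at layer `b`): `y(Z + A) ≤ (1−y)C`. [this work] -/
theorem fourAtom_H3_of_decAt (y : ℝ) (M a b c : ℕ) (Z A B C : ℝ) (ha : 0 < a) (hab : a < b) (hbc : b < c)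
    (hcM : c ≤ M) (hZ : 0 ≤ Z) (hA : 0 ≤ A) (hB : 0 ≤ B) (hC : 0 ≤ C) (hsum : Z + A + B + C = 1) (hy0 : 0 < y) (hy1 : y < 1)
    (h2a : 2 * (a : ℝ) < (a : ℝ) * A + (b : ℝ) * B + (c : ℝ) * C)
    (hab_le : (a : ℝ) + b ≤ (a : ℝ) * A + (b : ℝ) * B + (c : ℝ) * C)
    (h2b : (a : ℝ) * A + (b : ℝ) * B + (c : ℝ) * C ≤ 2 * (b : ℝ))
    (hD : DECAt y b M (fun h => QD[a, b, c, Z, A, B, C, h])) : y * (Z + A) ≤ (1 - y) * C := by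
  have h := fourAtom_midDual_of_decAt y M a b c Z A B C ha hab hbc hcM hZ hA hB hC hsum hy0 hy1 h2a hD
  rw [if_neg (not_lt.2 h2b), if_neg (not_lt.2 h2b), if_neg (not_lt.2 hab_le), add_zero, zero_add] at h
  have h1y : 0 < 1 - y := by linarith
  rwa [div_mul_eq_mul_div, div_le_iff₀ h1y, mul_comm C] at h

/-- **C1 IS NECESSARY** (`2a < T < a + b`, DEC at layer `b`): `y·(Z + A − B/usage(a,b)) ≤ (1−y)·C`. [this work] -/
theorem fourAtom_C1_of_decAt (y : ℝ) (M a b c : ℕ) (Z A B C : ℝ) (ha : 0 < a) (hab : a < b) (hbc : b < c)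
    (hcM : c ≤ M) (hZ : 0 ≤ Z) (hA : 0 ≤ A) (hB : 0 ≤ B) (hC : 0 ≤ C) (hsum : Z + A + B + C = 1) (hy0 : 0 < y) (hy1 : y < 1)
    (h2a : 2 * (a : ℝ) < (a : ℝ) * A + (b : ℝ) * B + (c : ℝ) * C)
    (hcomp : (a : ℝ) * A + (b : ℝ) * B + (c : ℝ) * C < (a : ℝ) + b)
    (hD : DECAt y b M (fun h => QD[a, b, c, Z, A, B, C, h])) :
    y * (Z + A - B / usage y ((a : ℝ) * A + (b : ℝ) * B + (c : ℝ) * C) b a b) ≤ (1 - y) * C := by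
  have hab' : (a : ℝ) < b := by exact_mod_cast hab
  have h2b : ¬ (2 * (b : ℝ) < (a : ℝ) * A + (b : ℝ) * B + (c : ℝ) * C) := by linarith
  have h := fourAtom_midDual_of_decAt y M a b c Z A B C ha hab hbc hcM hZ hA hB hC hsum hy0 hy1 h2a hD
  rw [if_neg h2b, if_neg h2b, if_pos hcomp, add_zero] at h
  have h1y : 0 < 1 - y := by linarith
  have hr := usage_pos_of_compat y ((a : ℝ) * A + (b : ℝ) * B + (c : ℝ) * C) b a b hy0 hy1 h2a hab (Or.inr hcomp)
  set r := usage y ((a : ℝ) * A + (b : ℝ) * B + (c : ℝ) * C) b a b with hr'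
  have e : y / (1 - y) / r * B = y / (1 - y) * (B / r) := by field_simp
  rw [e] at h
  have : y / (1 - y) * (Z + A - B / r) ≤ C := by nlinarith
  rwa [div_mul_eq_mul_div, div_le_iff₀ h1y, mul_comm C] at this

/-! ### The characterisation -/

/-- **REGIME (i) `2b < T`: DEC at every layer ⟺ `y ≤ C`** (four-atom law with a zero atom, `y·M ≤ T`). [this work] -/
theorem fourAtom_decAt_all_iff_threeLows (y : ℝ) (M a b c : ℕ) (Z A B C : ℝ) (ha : 0 < a) (hab : a < b) (hbc : b < c)
    (hcM : c ≤ M) (hZ : 0 ≤ Z) (hA : 0 ≤ A) (hB : 0 ≤ B) (hC : 0 ≤ C) (hsum : Z + A + B + C = 1) (hy0 : 0 < y) (hy1 : y < 1)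
    (hta : y * (M : ℝ) ≤ (a : ℝ) * A + (b : ℝ) * B + (c : ℝ) * C)
    (h2b : 2 * (b : ℝ) < (a : ℝ) * A + (b : ℝ) * B + (c : ℝ) * C) :
    (∀ j', j' < M → DECAt y j' M (fun h => QD[a, b, c, Z, A, B, C, h])) ↔ y ≤ C :=
  ⟨fun hD => fourAtom_H2_of_decAt y M a b c Z A B C ha hab hbc hcM hZ hA hB hC hsum hy0 hy1 h2b (hD b (by omega)),
    fun hH2 => fourAtom_decAt_all_of_threeLows y M a b c Z A B C ha hab hbc hcM hZ hA hB hC hsum hy0 hy1 hta hH2⟩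

/-- **REGIME (ii) `2a < T`, `a + b ≤ T ≤ 2b`: DEC at every layer ⟺ `y(Z + A) ≤ (1−y)C`.** [this work] -/
theorem fourAtom_decAt_all_iff_incompatible (y : ℝ) (M a b c : ℕ) (Z A B C : ℝ) (ha : 0 < a) (hab : a < b) (hbc : b < c)
    (hcM : c ≤ M) (hZ : 0 ≤ Z) (hA : 0 ≤ A) (hB : 0 ≤ B) (hC : 0 ≤ C) (hsum : Z + A + B + C = 1) (hy0 : 0 < y) (hy1 : y < 1)
    (hta : y * (M : ℝ) ≤ (a : ℝ) * A + (b : ℝ) * B + (c : ℝ) * C)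
    (h2a : 2 * (a : ℝ) < (a : ℝ) * A + (b : ℝ) * B + (c : ℝ) * C)
    (hab_le : (a : ℝ) + b ≤ (a : ℝ) * A + (b : ℝ) * B + (c : ℝ) * C)
    (h2b : (a : ℝ) * A + (b : ℝ) * B + (c : ℝ) * C ≤ 2 * (b : ℝ)) :
    (∀ j', j' < M → DECAt y j' M (fun h => QD[a, b, c, Z, A, B, C, h])) ↔ y * (Z + A) ≤ (1 - y) * C :=
  ⟨fun hD => fourAtom_H3_of_decAt y M a b c Z A B C ha hab hbc hcM hZ hA hB hC hsum hy0 hy1 h2a hab_le h2b (hD b (by omega)),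
    fun hH3 => fourAtom_decAt_all_of_incompatible y M a b c Z A B C ha hab hbc hcM hZ hA hB hC hsum hy0 hy1 hta h2b hH3⟩

/-- **REGIME (iii) `2a < T < a + b`: DEC at every layer ⟺ H1 ∧ C1** (`y ≤ B + C` and `y(Z + A − B/usage(a,b)) ≤ (1−y)C`).
[this work] -/
theorem fourAtom_decAt_all_iff_corner (y : ℝ) (M a b c : ℕ) (Z A B C : ℝ) (ha : 0 < a) (hab : a < b) (hbc : b < c)
    (hcM : c ≤ M) (hZ : 0 ≤ Z) (hA : 0 ≤ A) (hB : 0 ≤ B) (hC : 0 ≤ C) (hsum : Z + A + B + C = 1) (hy0 : 0 < y) (hy1 : y < 1)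
    (hta : y * (M : ℝ) ≤ (a : ℝ) * A + (b : ℝ) * B + (c : ℝ) * C)
    (h2a : 2 * (a : ℝ) < (a : ℝ) * A + (b : ℝ) * B + (c : ℝ) * C)
    (hcomp : (a : ℝ) * A + (b : ℝ) * B + (c : ℝ) * C < (a : ℝ) + b) :
    (∀ j', j' < M → DECAt y j' M (fun h => QD[a, b, c, Z, A, B, C, h])) ↔
      (y ≤ B + C ∧ y * (Z + A - B / usage y ((a : ℝ) * A + (b : ℝ) * B + (c : ℝ) * C) b a b) ≤ (1 - y) * C) :=
  ⟨fun hD => ⟨fourAtom_H1_of_decAt y M a b c Z A B C ha hab hbc hcM hZ hA hB hC hsum hy0 hy1 h2a (hD a (by omega)),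
      fourAtom_C1_of_decAt y M a b c Z A B C ha hab hbc hcM hZ hA hB hC hsum hy0 hy1 h2a hcomp (hD b (by omega))⟩,
    fun h => fourAtom_decAt_all_of_corner y M a b c Z A B C ha hab hbc hcM hZ hA hB hC hsum hy0 hy1 hta h2a hcomp h.1 h.2⟩

end LawDec

end Quant

end Summit.CriticalPhenomena.PercolationContinuityZ3.Theorems
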